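import Summits.BirchSwinnertonDyer.BirchSwinnertonDyer.Theorems.ByReductionTypeAtTwoMultUpperHalf
import Summits.BirchSwinnertonDyer.BirchSwinnertonDyer.Theses.ByReductionTypeAtTwo
import Summits.BirchSwinnertonDyer.Rank1Residual.X5.TwoAdicTargetsMultKatoInt
import Summits.BirchSwinnertonDyer.Rank1Residual.X5.TwoAdicTargetsEndStateClosed
import HarnessLib

/-!
# Route `ByReductionTypeAtTwo`, crux `MultUpperHalfAtTwo` (item stmt-BirchSwinnertonDyer-19922), third file:
# the integral-Kato door T-KATO2-NSMULT (non-split `2`, `ρ_{E,2^∞}` surjective, `Δ < 0`) is a THIRD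
# escape from the residual of the class theorem — no `μ`, no `λ`, no certificate

HONEST FRAMING (cell `bsd-2adic`, run/shared/lean/pub/bsd-2adic/, seat `bsd-2adic-mult-2` GEN 2, D-0074
row (A)): research route; nothing is booked; BSD is not proved by any of this. PARTITION: X5@2 mult
(K4ᵐ, RESIDUAL-MAP B1·O1; 1 976 book230 classes) × p = 2 — types-the-object-of (the residual of item
19922 loses the «non-split ∧ surjective ∧ `Δ < 0`» optimal curves: 814 of the 1 680 `E[2]`-irreducible
classes of record, CENSUS-6 kit j248824); closes none.

State of the item after p418902 / p420150 / p420550 (seat GEN 0): `MultUpperHalfAtTwo` ⟸ PRINT ×7 +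
MEMO {Kato `⊗ℚ` at a multiplicative `2` (`KatoRatAtMultTwo`, RC-2), Greenberg–Stevens at a split `2`
(`GreenbergStevensAtSplitTwo`, RC-4)} + the residual `UpperHalfOffRoadAtMultTwo` = the upper half at the
`X₀(N)`-optimal curves whose cyclotomic `μ` is not known to vanish (no `μ = 0`, no Prop-5.14 datum).
NEW INPUT (cell seat `bsd-2adic-mult` GEN 6, kernel p419632 `X5/TwoAdicTargetsMultKatoInt.lean`, memo
HOME/mult/PROOF-KATO2MULT.md v1 @68e39902a1e487ca, referee pending): the displayed statement
`O1.KatoDivisibilityAtTwoNonsplitMultInt W` — Kato's divisibility `char_Λ X(E/ℚ_∞) ∋ L₀`, `ι L₀ = ϖ·L`,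
IN `Λ = ℤ₂⟦T⟧` with the `2`-power part, for `W` NON-SPLIT multiplicative at `2` with
`ρ_{E,2^∞}(G_ℚ) = GL₂(ℤ₂)` and `Δ_W < 0` — and its PROVED per-curve consumer
`O1.missingUpperBoundAt_two_nonsplit_of_katoInt` (the upper half at such a `W` from PRINT {A235,
modularity, GZK} + the door + the period datum `0 ≤ ord₂ ϖ`). This file folds the door into the class
road of item 19922 (the period datum is PRINT on the door's locus: surjective ⇒ `E[2]` irreducible,
`O1.irr_two_of_twoAdicSurjective`, ⇒ `ord₂ ϖ = 0`, `padicValRat_periodRatio_eq_zero_of_irr_two` with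
Česnavičius 2018 Thm. 1.2; the companion file `…MultUpperHalfKatoIntLeaf.lean` reads the door one level
down, as the integral divisibility `IntegralKatoAtOptimalMultTwo` of p420150 at such curves):

* §1 `missingUpperBoundAt_two_mult_of_katoIntMember` — class theorem: for `W` of analytic rank `0`
  multiplicative at `2`, ONE globally minimal `W₁ ~_ℚ W` that is non-split, `2`-adically surjective, of
  negative discriminant and satisfies the door gives `MissingUpperBoundAt W 2` (door consumer at `W₁`,
  Cassels transport `X12.missingUpperBoundAt_of_isIsogenous`). Binders: PRINT {`h41ns`, `hmod`, `hGZK`,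
  `hCassels`, `hC`} + MEMO {the door at `W₁`}; NO `μ`, NO `λ`, NO certificate, NO Greenberg–Stevens.
* §2 **`multUpperHalfAtTwo_of_katoInt_of_optimalMuZero_of_offRoads`** — the FULLY-QUALIFIED route decl
  `…Theses.ByReductionTypeAtTwo.MultUpperHalfAtTwo` from PRINT ×7 + MEMO {`hKato`, `hGS`, `hKint` = the
  door for every curve} + ONE residual `hoff`: the upper half at the `X₀(N)`-optimal curves (non-CM,
  analytic rank `0`, multiplicative at `2`, lattice-optimal datum) with (i) no `μ = 0`, (ii) no Prop-5.14
  datum AND (iii) NOT (non-split ∧ `TwoAdicSurjective` ∧ `Δ < 0`). The residual of p418902 minus the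
  door's locus; on the census of record: the 142 «neither» classes + the `E[2]`-irreducible classes that
  are split at `2` (566), not `2`-adically surjective (52) or of positive discriminant (248) and carry no
  `μ`-certificate — a partition certificate, not a proof of the item.

References: [Kato2004Asterisque] Prop. 17.11–Lemma 17.12, Thm. 17.13, Thm. 16.6; [Rubin2000EulerSystems]
Thm. II.3.8; [GreenbergLNM1716] §4 pp. 112–113, Prop. 5.13/5.14 (pp. 120–122) and the conductor-195
example (p. 124: the «neither» point `(6, −3)` of 195A1); [Cesnavicius2018] Thm. 1.2;
[Cassels1965ArithmeticVIII]; [Miller2011LMS] Def. 1.1; [Serre1972] §4.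
-/

set_option autoImplicit false
set_option linter.dupNamespace false

noncomputable section

open scoped Classical MatrixGroups ModularForm

open CongruenceSubgroup WeierstrassCurve Literature.NumberTheory.EllipticCurves
  Literature.NumberTheory.EllipticCurves.ModularForms
  Literature.NumberTheory.EllipticCurves.Greenberg1999
  Literature.NumberTheory.EllipticCurves.Rank1Residual
  Literature.NumberTheory.EllipticCurves.Rank1Residual.Typed
  Summit.BirchSwinnertonDyer.Rank1Residual.X5

namespace Summit.BirchSwinnertonDyer.BirchSwinnertonDyer.Theorems

/-! ## §1 The class theorem through the door -/

/-- **The upper half at a multiplicative `2` from ONE door member of the isogeny class.** For a globally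
minimal elliptic `W/ℚ` of analytic rank `0` multiplicative at `2` and a globally minimal `W₁ ~_ℚ W` that is
NON-SPLIT at `2`, `2`-adically surjective (`O1.TwoAdicSurjective W₁`), of negative discriminant and satisfies
the door `O1.KatoDivisibilityAtTwoNonsplitMultInt W₁` (memo PROOF-KATO2MULT Thm. A): `MissingUpperBoundAt
W 2`. Class data move to `W₁` (`X2.IsogenyQuotientLine.hasMultiplicativeReductionAtPrime_of_isIsogenous`,
`analyticRank_eq_of_isIsogenous'`); the door's own consumer `O1.missingUpperBoundAt_two_nonsplit_of_katoInt`
(A235 `h41ns`: the `l_v = 2` cancels MTT's `(1 − α⁻¹) = 2`; slack `k = 0`) gives the half at `W₁` with the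
period datum PRINT (irreducible ⇒ `ord₂ ϖ = 0`, `padicValRat_periodRatio_eq_zero_of_irr_two`, `hC`);
Cassels (`X12.missingUpperBoundAt_of_isIsogenous`, `hCassels`) carries it to `W`. Binders: PRINT {`h41ns`,
`hmod`, `hGZK`, `hCassels`, `hC`} + MEMO {the door at `W₁`}; no `μ`, no `λ`, no certificate, no
Greenberg–Stevens (non-split). (With a surjective member all
`ℚ`-isogenies of the class have odd degree, so every member is such a `W₁`; the theorem does not use this.)
[cite: GreenbergLNM1716, §4 pp. 112–113] [cite: MazurTateTeitelbaum1986Invent, §I.10 and §I.14]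
[cite: Cesnavicius2018, Thm. 1.2] [cite: Cassels1965ArithmeticVIII] [cite: Miller2011LMS, §1 and Def. 1.1] -/
theorem missingUpperBoundAt_two_mult_of_katoIntMember
    (h41ns : thm41Analogue_charValue_rankZero_numberField_anyPrime)
    (hmod : nonempty_modularParametrizationData)
    (hGZK : rank_eq_analyticRank_of_analyticRank_le_one)
    (hCassels : bsdRHS_eq_of_isIsogenous)
    (hC : cesnavicius_not_two_dvd_maninConstant_of_two_dvd_level)
    (W : WeierstrassCurve ℚ) [W.IsElliptic] [W.IsGloballyMinimal]
    (hr : W.analyticRank = 0) (hmult : Mult W 2)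
    (W₁ : WeierstrassCurve ℚ) [W₁.IsElliptic] [W₁.IsGloballyMinimal] (hiso : IsIsogenous W W₁)
    (hns₁ : ¬ W₁.HasSplitMultiplicativeReductionAtPrime 2) (him₁ : O1.TwoAdicSurjective W₁)
    (hΔ₁ : W₁.Δ < 0) (hKint₁ : O1.KatoDivisibilityAtTwoNonsplitMultInt W₁) :
    MissingUpperBoundAt W 2 := by
  -- the class data at `W₁`
  have hmult₁ : Mult W₁ 2 :=
    Summit.BirchSwinnertonDyer.Rank1Residual.X2.IsogenyQuotientLine.hasMultiplicativeReductionAtPrime_of_isIsogenous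
      hiso hmult
  have hr₁ : W₁.analyticRank = 0 := (analyticRank_eq_of_isIsogenous' hiso).symm.trans hr
  have hirr₁ : Irr W₁ 2 := O1.irr_two_of_twoAdicSurjective W₁ him₁
  -- the period datum at `W₁` is PRINT (irreducible)
  have hper₁ : ∀ [NeZero (W₁.conductorNorm ℤ)] (f : CuspForm (Gamma0 (W₁.conductorNorm ℤ)) 2),
      IsNewformOf W₁ f → ∀ ϖ : ℚ, (ϖ : ℝ) * W₁.realPeriodRat = plusPeriod f →
        0 ≤ padicValRat 2 ϖ :=
    fun f hf ϖ hϖ ↦ (padicValRat_periodRatio_eq_zero_of_irr_two hC W₁ hmult₁ hirr₁ f hf ϖ hϖ).ge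
  -- the door's consumer at `W₁`, then Cassels
  have hU₁ : MissingUpperBoundAt W₁ 2 :=
    O1.missingUpperBoundAt_two_nonsplit_of_katoInt W₁ h41ns hmod hGZK hKint₁ hper₁ hr₁ hmult₁ hns₁
      him₁ hΔ₁
  haveI : NeZero (W₁.conductorNorm ℤ) := ⟨(W₁.conductorNorm_pos_holds).ne'⟩
  obtain ⟨Dm⟩ := hmod W₁
  have hlead₁ : W₁.leadingLCoeff ≠ 0 :=
    W₁.leadingLCoeff_ne_zero_holds Dm.isNewformOf.hasEntireLFunction
  have hfin₁ : Finite W₁.sha := (hGZK W₁ (by rw [hr₁]; exact zero_le_one)).2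
  exact Summit.BirchSwinnertonDyer.Rank1Residual.X12.missingUpperBoundAt_of_isIsogenous hCassels hiso
    hfin₁ hlead₁ hU₁

/-! ## §2 The crux decl: three roads at the optimal curve + the typed residual -/

/-- **Item stmt-BirchSwinnertonDyer-19922 `MultUpperHalfAtTwo` as «optimal-μ-zero ⊔ optimal-5.14 ⊔
integral-Kato-door sub-blocks + residual» (conditional; FULLY-QUALIFIED type).** PRINT {A235 `h41ns`,
A236 `h41sp`, modularity `hmod`, GZK `hGZK`, Cassels `hCassels`, Greenberg Prop. 5.14 at `2` `h514`,
Česnavičius Thm. 1.2 `hC`} + MEMO {Kato `⊗ℚ` at a multiplicative `2` `hKato` (PROOF-MULT, RC-2),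
Greenberg–Stevens at a split `2` `hGS` (PROOF-GS2, RC-4), T-KATO2-NSMULT `hKint` (PROOF-KATO2MULT Thm. A,
referee pending; the displayed `O1.KatoDivisibilityAtTwoNonsplitMultInt` for every curve — vacuous off its
guard)} + ONE residual hypothesis `hoff` — the upper half AT THE `X₀(N)`-OPTIMAL CURVES `W₀` (globally
minimal, non-CM, analytic rank `0`, multiplicative at `2`, lattice-optimal parametrisation datum at level
`N_{W₀}`) with (i) cyclotomic `μ` not known to vanish, (ii) no Prop-5.14 datum, and (iii) NOT (non-split at
`2` ∧ `O1.TwoAdicSurjective W₀` ∧ `Δ_{W₀} < 0`) — imply `MultUpperHalfAtTwo`. Proof: every class has an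
optimal member (`X12.exists_isIsogenous_optimal`); on it road (i)/(ii) is p418902's
`missingUpperBoundAt_two_mult_of_roadMember`, road (iii) is §1 with `W₁ := W₀`, and `hoff` covers the rest;
Cassels moves the half to every member. The residual is expected NON-EMPTY (split `2`, non-surjective or
positive-discriminant irreducible classes without a `μ`-certificate; the 142 «neither» classes, cf.
Greenberg's 195A1, LNM 1716 p. 124), so this is a partition certificate, not a proof of the item.
[cite: Kato2004Asterisque, Thm. 17.4 (p. 273) and 17.11–17.13 (pp. 277–280)]
[cite: GreenbergLNM1716, Prop. 5.13, Prop. 5.14 (pp. 120–122), §4 pp. 112–113 and p. 124 (195A1)]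
[cite: Cesnavicius2018, Thm. 1.2] [cite: Cassels1965ArithmeticVIII] [cite: Miller2011LMS, Def. 1.1] -/
theorem multUpperHalfAtTwo_of_katoInt_of_optimalMuZero_of_offRoads
    (hKato : ∀ (W : WeierstrassCurve ℚ) [W.IsElliptic] [W.IsGloballyMinimal],
      ¬ W.HasCM → Mult W 2 → O1.KatoMultiplicativeDivisibilityRat W 2)
    (h41ns : thm41Analogue_charValue_rankZero_numberField_anyPrime)
    (h41sp : thm41Analogue_charValue_rankZero_split_baseChange_anyPrime)
    (hmod : nonempty_modularParametrizationData)
    (hGZK : rank_eq_analyticRank_of_analyticRank_le_one)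
    (hCassels : bsdRHS_eq_of_isIsogenous)
    (h514 : prop514_isTorsion_mu_eq_zero_two)
    (hC : cesnavicius_not_two_dvd_maninConstant_of_two_dvd_level)
    (hGS : ∀ (W : WeierstrassCurve ℚ) [W.IsElliptic] [W.IsGloballyMinimal],
      W.HasSplitMultiplicativeReductionAtPrime 2 → greenberg_stevens (W := W) (p := 2))
    (hKint : ∀ (W : WeierstrassCurve ℚ) [W.IsElliptic] [W.IsGloballyMinimal],
      O1.KatoDivisibilityAtTwoNonsplitMultInt W)
    (hoff : ∀ (W₀ : WeierstrassCurve ℚ) [W₀.IsElliptic] [W₀.IsGloballyMinimal]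
      [NeZero (W₀.conductorNorm ℤ)], ¬ W₀.HasCM → W₀.analyticRank = 0 → Mult W₀ 2 →
      ∀ D₀ : ModularParametrizationData W₀ (W₀.conductorNorm ℤ), Zhai2021.IsOptimalDatum W₀ D₀ →
      (¬ ∀ (κ : ZpExtension ℚ 2) (γ : Field.absoluteGaloisGroup ℚ), κ.IsCyclotomic →
          κ.IsTopGenerator γ → IsCyclotomicVariable 2 γ → ∀ D : W₀.SelmerDualData κ γ, D.mu = 0) →
      (¬ ∃ x y : ℚ, W₀.toAffine.Equation x y ∧ 2 * y + W₀.a₁ * x + W₀.a₃ = 0 ∧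
          ((TwoTorsionRamifiedAtTwo x ∧ ¬ TwoTorsionOdd W₀ x) ∨
            (TwoTorsionOdd W₀ x ∧ ¬ TwoTorsionRamifiedAtTwo x))) →
      ¬ (¬ W₀.HasSplitMultiplicativeReductionAtPrime 2 ∧ O1.TwoAdicSurjective W₀ ∧ W₀.Δ < 0) →
      MissingUpperBoundAt W₀ 2) :
    Summit.BirchSwinnertonDyer.BirchSwinnertonDyer.Theses.ByReductionTypeAtTwo.MultUpperHalfAtTwo := by
  unfold Summit.BirchSwinnertonDyer.BirchSwinnertonDyer.Theses.ByReductionTypeAtTwo.MultUpperHalfAtTwo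
  intro W _ _ _ hr hmult
  have hnf : exists_isNewformOf := exists_isNewformOf_of_nonempty_modularParametrizationData hmod
  -- the optimal member of the class
  obtain ⟨W₀, hE₀, hM₀, hN₀, D₀, hiso, -, hopt⟩ :=
    Summit.BirchSwinnertonDyer.Rank1Residual.X12.exists_isIsogenous_optimal hnf W
  -- road (i): `μ = 0` at `W₀`
  by_cases hμ₀ : ∀ (κ : ZpExtension ℚ 2) (γ : Field.absoluteGaloisGroup ℚ), κ.IsCyclotomic →
      κ.IsTopGenerator γ → IsCyclotomicVariable 2 γ → ∀ D : W₀.SelmerDualData κ γ, D.mu = 0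
  · exact missingUpperBoundAt_two_mult_of_roadMember hKato h41ns h41sp hmod hGZK hCassels h514 hC hGS
      W hr hmult W₀ hiso (Or.inl hμ₀) (Or.inr (Or.inl fun {_} ↦ ⟨D₀, hopt⟩))
  -- road (ii): a Prop-5.14 datum at `W₀`
  by_cases h514₀ : ∃ x y : ℚ, W₀.toAffine.Equation x y ∧ 2 * y + W₀.a₁ * x + W₀.a₃ = 0 ∧
      ((TwoTorsionRamifiedAtTwo x ∧ ¬ TwoTorsionOdd W₀ x) ∨
        (TwoTorsionOdd W₀ x ∧ ¬ TwoTorsionRamifiedAtTwo x))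
  · exact missingUpperBoundAt_two_mult_of_roadMember hKato h41ns h41sp hmod hGZK hCassels h514 hC hGS
      W hr hmult W₀ hiso (Or.inr h514₀) (Or.inr (Or.inl fun {_} ↦ ⟨D₀, hopt⟩))
  -- road (iii): the integral-Kato door at `W₀`
  by_cases hdoor : ¬ W₀.HasSplitMultiplicativeReductionAtPrime 2 ∧ O1.TwoAdicSurjective W₀ ∧ W₀.Δ < 0
  · exact missingUpperBoundAt_two_mult_of_katoIntMember h41ns hmod hGZK hCassels hC W hr hmult W₀ hiso
      hdoor.1 hdoor.2.1 hdoor.2.2 (hKint W₀)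
  -- off the roads: the residual hypothesis at `W₀`, then Cassels
  have hmult₀ : Mult W₀ 2 :=
    Summit.BirchSwinnertonDyer.Rank1Residual.X2.IsogenyQuotientLine.hasMultiplicativeReductionAtPrime_of_isIsogenous
      hiso hmult
  have hr₀ : W₀.analyticRank = 0 := (analyticRank_eq_of_isIsogenous' hiso).symm.trans hr
  have hcm₀ : ¬ W₀.HasCM := fun h ↦ Rank1Residual.not_mult_of_hasCM W₀ h 2 hmult₀
  have hU₀ : MissingUpperBoundAt W₀ 2 := hoff W₀ hcm₀ hr₀ hmult₀ D₀ hopt hμ₀ h514₀ hdoor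
  obtain ⟨Dm⟩ := hmod W₀
  have hlead₀ : W₀.leadingLCoeff ≠ 0 :=
    W₀.leadingLCoeff_ne_zero_holds Dm.isNewformOf.hasEntireLFunction
  have hfin₀ : Finite W₀.sha := (hGZK W₀ (by rw [hr₀]; exact zero_le_one)).2
  exact Summit.BirchSwinnertonDyer.Rank1Residual.X12.missingUpperBoundAt_of_isIsogenous hCassels hiso
    hfin₀ hlead₀ hU₀

end Summit.BirchSwinnertonDyer.BirchSwinnertonDyer.Theorems

end
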